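import Literature.Computability.MetaComplexity.EFModMulUZero
import HarnessLib

/-!
# Comparison transfer blocks: bitwise domination, shifts, disjoint sums

Layer E/5 (uniform variant). Three blocks on comparators `(x, n)` (`EFSub.lean`) used by the
unit, shift and commutativity laws of modular multiplication:

* `ModMulU.Shift.transferEqvLines` — transfer of `<` along bitwise *provably equal* operands
  (`Sub.leibLines` + one inference);
* `ModMulU.Shift.monoLines` — **domination**: `x ≤ a` bitwise (premise lines `¬xᵢ ∨ aᵢ`) and
  `a < n` give `x < n` (system `MONO`);
* `ModMulU.Shift.shiftT` — **the shift kit**: on the inputs `b, n, z` (`2L + 1`, `z` the zero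
  gate) a comparator of `b >> 1 = (b₁, …, b_{L-1}, z)` with `n`, copy gates and a flag; its
  block derives `b >> 1 < n` from `b < n` (system `SHIFTR`);
* `ModMulU.Shift.dorLines` — **disjoint sum**: the sum bits of an adder on words of disjoint
  support are the disjunctions (system `DOR`).

## Sources

* S. A. Cook, R. A. Reckhow, *The relative efficiency of propositional proof systems*,
  J. Symbolic Logic 44 (1979), §2.
* H. Vollmer, *Introduction to Circuit Complexity* (Springer 1999), §1.2.
-/

namespace Literature.Computability.MetaComplexity

open _root_.Computability Complexity Complexity.PropForm Netlist Cluster FregeSystem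

namespace ModMulU

namespace Shift

variable {G : FregeSystem} {K : PropForm ℕ} {T : Set (PropForm ℕ)} {L : ℕ}

/-! ### Transfer along provably equal operands -/

/-- The lines transferring `<` from `A'` to `A` along bitwise equal operands. [folklore] -/
def transferEqvLines (A' A : Sub.View) (K : PropForm ℕ) (L : ℕ) : List (PropForm ℕ) :=
  Sub.leibLines A' A K L ++ [ctx K (neg (var (A.ge L L)))]

/-- **Transfer of a strict comparison along provably equal operands.** [cite: CookReckhow1979, §2] -/
theorem isBlock_transferEqvLines (hGN : ∀ r ∈ Netlist.rules, r ∈ G.rules) (hGL : ∀ r ∈ Logic.rules, r ∈ G.rules)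
    {A' A : Sub.View} (hA' : A'.Avail K T L) (hA : A.Avail K T L) (hx : ∀ i < L, ctx K (eqv (A'.x i) (A.x i)) ∈ T)
    (hy : ∀ i < L, ctx K (eqv (A'.y i) (A.y i)) ∈ T) (hlt : ctx K (neg (var (A'.ge L L))) ∈ T) :
    G.IsBlock T (transferEqvLines A' A K L) :=
  (Sub.isBlock_leibLines hGN hGL A' A hA' hA hx hy).append (FregeSystem.IsBlock.singleton (Or.inr (Logic.infer hGL 8 (by decide)
    (FregeSystem.sub [K, var (A'.ge L L), var (A.ge L L)]) rfl (FregeSystem.prems_cons (Or.inl hlt) (FregeSystem.prems_cons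
      (Or.inr (Sub.mem_leibLines (k := 2 * L) (by omega))) FregeSystem.prems_nil)))))

/-- The conclusion of the transfer. [folklore] -/
theorem mem_transferEqvLines (A' A : Sub.View) (K : PropForm ℕ) (L : ℕ) :
    ctx K (neg (var (A.ge L L))) ∈ transferEqvLines A' A K L := List.mem_append_right _ (List.mem_singleton_self _)

/-- Size of the transfer. [folklore] -/
theorem proofSize_transferEqvLines (A' A : Sub.View) (K : PropForm ℕ) (L : ℕ) :
    proofSize (transferEqvLines A' A K L) ≤ (3 * L + 2) * (K.size + 10) := by
  refine ((ModAddU.bounded_subLeib A' A K L le_rfl).append (ModAddU.Bounded.singleton ?_)).proofSize_le.trans ?_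
  · rw [ModAddU.size_ctx]; simp [size]
  · simp [Sub.leibLines, Adder.leibLines]; nlinarith

/-! ### Domination -/

/-- Leaf assignment of `MONO` for the comparators `A = (a, n)` and `X = (x, n)`. [folklore] -/
def monoAct (A X : Sub.View) (L i : ℕ) (k : ℕ) : ℕ :=
  [0, A.ge L i, X.ge L i, A.x i, X.x i, A.y i, A.ny i, A.ge L (i + 1), X.ny i, X.ge L (i + 1)].getD k 0

/-- The domination lines: the induction of `MONO` and its end. [folklore] -/
def monoLines (A X : Sub.View) (K : PropForm ℕ) (L : ℕ) : List (PropForm ℕ) :=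
  Sys.MONO.lines K (monoAct A X L) L ++ [ctx K (inst (monoAct A X L L) (neg (var 2)))]

/-- **Domination**: `x ≤ a` bitwise (premise lines `¬xᵢ ∨ aᵢ`) and `a < n` give `x < n`.
[cite: CookReckhow1979, §2] -/
theorem isBlock_monoLines (hGY : ∀ r ∈ Sys.sysRules, r ∈ G.rules) {A X : Sub.View} (hA : A.Avail K T L) (hX : X.Avail K T L)
    (hy : ∀ i < L, X.y i = A.y i) (himp : ∀ i < L, ctx K (disj (neg (var (X.x i))) (var (A.x i))) ∈ T)
    (hlt : ctx K (neg (var (A.ge L L))) ∈ T) : G.IsBlock T (monoLines A X K L) := by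
  refine (System.isBlock_lines Sys.monoLeavesOK (hGY _ (Sys.mem_sysRules (i := 3) (by decide)))
    (hGY _ (Sys.mem_sysRules (i := 4) (by decide))) K (monoAct A X L) L
    (ModAddU.hcoh_of (p := fun k => decide (1 ≤ k ∧ k ≤ 2)) (by decide +kernel) fun i _ k hk => by
      simp only [decide_eq_true_eq] at hk
      obtain ⟨hk₁, hk₂⟩ := hk
      interval_cases k <;> rfl)
    (fun φ hφ => by
      simp only [Sys.MONO, List.mem_cons, List.not_mem_nil, or_false] at hφ
      rcases hφ with rfl | rfl
      exacts [hA.2.1, hX.2.1])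
    (fun i hi φ hφ => by
      simp only [Sys.MONO, List.mem_cons, List.not_mem_nil, or_false] at hφ
      rcases hφ with rfl | rfl | rfl | rfl | rfl
      · exact hA.1 i hi
      · exact (hA.2.2 i hi).2
      · show ctx K (biimp (var (X.ny i)) (neg (var (A.y i)))) ∈ T; rw [← hy i hi]; exact hX.1 i hi
      · exact (hX.2.2 i hi).2
      · exact himp i hi)).append (FregeSystem.IsBlock.singleton (Or.inr ?_))
  exact System.isInferredFrom_end Sys.monoLeavesOK.inv_ne_zero (hGY _ (Sys.mem_sysRules (i := 5) (by decide)))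
    (System.forall_ne_zero_of_shapesOKB (by decide +kernel)) (ModAddU.ne_zero_of_allVarsB (by decide +kernel)) K
    (monoAct A X L) L (Or.inr (System.mem_lines Sys.MONO K _ le_rfl)) fun φ hφ => by
      rw [List.mem_singleton.1 hφ]; exact Or.inl hlt

/-- The conclusion of domination: `x < n`. [folklore] -/
theorem mem_monoLines (A X : Sub.View) (K : PropForm ℕ) (L : ℕ) : ctx K (neg (var (X.ge L L))) ∈ monoLines A X K L :=
  List.mem_append_right _ (List.mem_singleton_self _)

/-- Size of domination. [folklore] -/
theorem proofSize_monoLines (A X : Sub.View) (K : PropForm ℕ) (L : ℕ) :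
    proofSize (monoLines A X K L) ≤ (L + 2) * (K.size + 40) := by
  have hI : Sys.MONO.inv.size ≤ 36 := by decide +kernel
  refine ((ModAddU.bounded_sysLines (B := K.size + 40) _ _ _ _ (by omega)).append (ModAddU.Bounded.singleton ?_)).proofSize_le.trans ?_
  · rw [ModAddU.size_ctx, ModAddU.size_inst]; simp [size]
  · simp [System.lines]

/-- **The domination premises for a masked word**: `x i = a i` or `x i` is the zero gate. [folklore] -/
theorem imp_line (hGS : ∀ r ∈ Sys.glue, r ∈ G.rules) {x a z : ℕ} (h : x = a ∨ x = z)
    (hz : ctx K (biimp (var z) (const false)) ∈ T) : ctx K (disj (neg (var x)) (var a)) ∈ T ∨ G.IsInferredFrom T (ctx K (disj (neg (var x)) (var a))) := by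
  rcases h with rfl | rfl
  · exact Or.inr (Sys.glue_infer hGS 12 (by decide) (FregeSystem.sub [K, var x]) rfl (by simp [Sys.glue, Sys.rImpRefl]))
  · refine Or.inr (Sys.glue_infer hGS 11 (by decide) (FregeSystem.sub [K, var x, var a]) rfl fun ψ hψ => ?_)
    simp only [Sys.glue, List.getElem_cons_succ, List.getElem_cons_zero, Sys.rImpOfCstF, List.mem_singleton] at hψ
    subst hψ; exact hz

/-! ### The shift kit -/

section Kit

variable (L)

/-- The copy gates `pxᵢ₊₁ ↔ hᵢ ∧ hᵢ` and the flag gate `f₀ ↔ ⊤`. [folklore] -/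
def copyT : Template := (List.range L).map (fun i => ⟨Kind.and, [Sum.inl i, Sum.inl i]⟩) ++ [⟨Kind.cst true, []⟩]

/-- The wiring of the shifted word `h = (b₁, …, b_{L-1}, z)` (kit inputs `b, n, z`). [folklore] -/
def hw (i : ℕ) : ℕ ⊕ ℕ := if i + 1 < L then Sum.inl (i + 1) else Sum.inl (2 * L)

/-- The pieces: the comparator `(h, n)` and the copy/flag gates on `h`. [folklore] -/
def pieces (k : ℕ) : Piece :=
  if k = 0 then ⟨Sub.subT L, 2 * L, fun i => if i < L then hw L i else Sum.inl i⟩ else ⟨copyT L, L, hw L⟩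

/-- **The shift kit.** [cite: Vollmer1999, §1.2] -/
def shiftT : Template := layout (pieces L) 2

/-- The copy template is well formed. [folklore] -/
theorem wf_copyT : (copyT L).WF L := by
  intro k hk
  simp only [copyT, List.length_append, List.length_map, List.length_range, List.length_singleton] at hk
  by_cases hkL : k < L
  · have e : (copyT L)[k]'(by simp [copyT]; omega) = ⟨Kind.and, [Sum.inl k, Sum.inl k]⟩ := by
      simp [copyT, hkL]
    rw [e]
    refine ⟨rfl, fun a ha => ?_⟩
    simp only [List.mem_cons, List.not_mem_nil, or_false, or_self] at ha
    subst ha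
    exact ⟨fun i h => by cases h; exact hkL, fun j h => by cases h⟩
  · have e : (copyT L)[k]'(by simp [copyT]; omega) = ⟨Kind.cst true, []⟩ := by
      have hk' : k = L := by omega
      subst hk'
      simp [copyT]
    rw [e]
    exact ⟨rfl, fun a ha => by simp at ha⟩

/-- **The shift kit is well formed** (`2L + 1` inputs). [cite: Vollmer1999, Def. 1.6] -/
theorem wf_shiftT : (shiftT L).WF (2 * L + 1) := by
  refine wf_layout (pieces L) fun k hk => ?_
  have hw_ok : ∀ i, (∀ a, hw L i = Sum.inl a → a < 2 * L + 1) ∧ ∀ g, hw L i = Sum.inr g → g < offset (pieces L) k := by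
    intro i; unfold hw; split_ifs <;> exact ⟨fun a ha => by cases ha; omega, fun g hg => by cases hg⟩
  rcases (show k = 0 ∨ k = 1 by omega) with rfl | rfl
  · refine ⟨by simp only [pieces, if_true]; exact Sub.wf_subT L, fun i hi => ?_⟩
    simp only [pieces, if_true] at hi ⊢
    split_ifs
    · exact hw_ok i
    · exact ⟨fun a ha => by cases ha; omega, fun g hg => by cases hg⟩
  · refine ⟨by simp only [pieces, show (1 : ℕ) ≠ 0 from by decide, if_false]; exact wf_copyT L, fun i hi => ?_⟩
    simp only [pieces, show (1 : ℕ) ≠ 0 from by decide, if_false] at hi ⊢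
    exact hw_ok i

variable (o : Occ)

/-- The word `b`. [folklore] -/
def bv (i : ℕ) : ℕ := o.inp i
/-- The modulus. [folklore] -/
def nv (i : ℕ) : ℕ := o.inp (L + i)
/-- The zero gate. [folklore] -/
def zv : ℕ := o.inp (2 * L)
/-- The shifted word `h = b >> 1`. [folklore] -/
def hv (i : ℕ) : ℕ := if i + 1 < L then o.inp (i + 1) else o.inp (2 * L)
/-- The comparator `(h, n)`. [folklore] -/
def H : Sub.View := ⟨o.base, hv L o, nv L o⟩
/-- The copy state `px`: `px₀ = z`, `pxᵢ₊₁` the copy gate `i`. [folklore] -/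
def px (i : ℕ) : ℕ := if i = 0 then o.inp (2 * L) else o.base + (3 * L + 1) + (i - 1)
/-- The flag `f`: `f₀` the true gate, `fᵢ₊₁ = z`. [folklore] -/
def fl (i : ℕ) : ℕ := if i = 0 then o.base + (3 * L + 1) + L else o.inp (2 * L)

/-- Availability of the kit: the comparator, the copy gates, the flag gate. [folklore] -/
structure SAvail (K : PropForm ℕ) (Γ : Set (PropForm ℕ)) : Prop where
  /-- the comparator -/
  hH : (H L o).Avail K Γ L
  /-- the copy gates -/
  hpx : ∀ i < L, ctx K (biimp (var (px L o (i + 1))) (conj (var (hv L o i)) (var (hv L o i)))) ∈ Γ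
  /-- the flag gate -/
  hfl : ctx K (biimp (var (fl L o 0)) (const true)) ∈ Γ

end Kit

variable {o : Occ} {Γ : Set (PropForm ℕ)}

/-- Availability of the kit is monotone. [folklore] -/
theorem SAvail.mono {Γ' : Set (PropForm ℕ)} (h : SAvail L o K Γ) (hΓ : Γ ⊆ Γ') : SAvail L o K Γ' :=
  ⟨h.hH.mono hΓ, fun i hi => hΓ (h.hpx i hi), hΓ h.hfl⟩

/-- **All pieces of an available occurrence of the shift kit are available.** [folklore] -/
theorem avail_ofOcc (ho : o.Avail (shiftT L) (2 * L + 1) K Γ) : SAvail L o K Γ := by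
  have h0 : (pieceOcc (o.inst (2 * L + 1)) (pieces L) 0).Avail (Sub.subT L) (2 * L) K Γ := by
    have := Inst.DefsAvail.piece ho (k := 0) (by norm_num) (by simp only [pieces, if_true]; exact Sub.wf_subT L)
    simp only [pieces, if_true] at this; exact this
  have h1 : (pieceOcc (o.inst (2 * L + 1)) (pieces L) 1).Avail (copyT L) L K Γ := by
    have := Inst.DefsAvail.piece ho (k := 1) (by norm_num)
      (by simp only [pieces, show (1 : ℕ) ≠ 0 from by decide, if_false]; exact wf_copyT L)
    simp only [pieces, show (1 : ℕ) ≠ 0 from by decide, if_false] at this; exact this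
  have hb1 : (pieceOcc (o.inst (2 * L + 1)) (pieces L) 1).base = o.base + (3 * L + 1) := by
    simp [pieceOcc, offset_succ, offset_zero, pieces, Sub.length_subT]
  have hinp : ∀ i, (o.inst (2 * L + 1)).ref (hw L i) = hv L o i := fun i => by
    unfold hw hv; split_ifs <;> exact Occ.ref_inl o (by omega)
  refine ⟨?_, fun i hi => ?_, ?_⟩
  · refine Sub.View.Avail.congr (Sub.avail_viewOf h0) ?_ (fun i hi => ?_) (fun i hi => ?_)
    · show o.base = (pieceOcc (o.inst (2 * L + 1)) (pieces L) 0).base; simp [pieceOcc, offset_zero]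
    · show hv L o i = ((pieceOcc (o.inst (2 * L + 1)) (pieces L) 0).inst (2 * L)).inputs.getD i 0
      rw [Occ.getD_inst _ (show i < 2 * L by omega), inp_pieceOcc]; simp only [pieces, if_true, if_pos hi, hinp]
    · show o.inp (L + i) = ((pieceOcc (o.inst (2 * L + 1)) (pieces L) 0).inst (2 * L)).inputs.getD (L + i) 0
      rw [Occ.getD_inst _ (show L + i < 2 * L by omega), inp_pieceOcc]
      simp only [pieces, if_true, if_neg (show ¬L + i < L by omega)]; exact (Occ.ref_inl o (by omega)).symm
  · have := h1 i (by simp [copyT]; omega)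
    have e : (copyT L)[i]'(by simp [copyT]; omega) = ⟨Kind.and, [Sum.inl i, Sum.inl i]⟩ := by
      simp [copyT, hi]
    rw [e] at this
    have ew : (((pieceOcc (o.inst (2 * L + 1)) (pieces L) 1).inst L).wire i) = px L o (i + 1) := by
      simp [Inst.wire, hb1, px]
    have er : ((pieceOcc (o.inst (2 * L + 1)) (pieces L) 1).inst L).ref (Sum.inl i) = hv L o i := by
      rw [Occ.ref_inl _ hi, inp_pieceOcc]; simp only [pieces, show (1 : ℕ) ≠ 0 from by decide, if_false, hinp]
    simpa [Inst.body, Kind.body, Netlist.arg, ew, er] using this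
  · have := h1 L (by simp [copyT])
    have e : (copyT L)[L]'(by simp [copyT]) = ⟨Kind.cst true, []⟩ := by simp [copyT]
    rw [e] at this
    have ew : (((pieceOcc (o.inst (2 * L + 1)) (pieces L) 1).inst L).wire L) = fl L o 0 := by
      simp [Inst.wire, hb1, fl]
    simpa [Inst.body, Kind.body, ew] using this

/-! ### The shift block -/

section Block

variable (L) (o : Occ) (K) (bB : ℕ)

/-- The comparator `(b, n)` of the consumer, at base `bB`. [folklore] -/
def B : Sub.View := ⟨bB, bv o, nv L o⟩

/-- Leaf assignment of `SHIFTR`. Leaves: 1 gB, 2 gH, 3 px, 4 f, 5 b, 6 b1, 7 n; defined: 8 nB,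
9 gB', 10 nH, 11 gH', 12 px', 13 f'. [folklore] -/
def act (i : ℕ) (k : ℕ) : ℕ :=
  [0, (B L o bB).ge L i, (H L o).ge L i, px L o i, fl L o i, bv o i, hv L o i, nv L o i, (B L o bB).ny i, (B L o bB).ge L (i + 1),
    (H L o).ny i, (H L o).ge L (i + 1), px L o (i + 1), zv L o].getD k 0

/-- The segments of the shift block. [folklore] -/
def segs : List (List (PropForm ℕ)) :=
  [(List.range (L - 1)).map (fun i => ctx K (biimp (var (bv o (i + 1))) (var (px L o (i + 1))))),   -- copies read
   (List.range L).map (fun i => ctx K (disj (var (fl L o i)) (biimp (var (bv o i)) (var (px L o i))))),   -- premises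
   Sys.SHIFTR.lines K (act L o bB) L,
   [ctx K (neg (var (px L o L)))],
   [ctx K (inst (act L o bB L) (neg (var 2)))]]

/-- **The lines of the shift block.** [folklore] -/
def lines : List (PropForm ℕ) := (segs K L o bB).flatten

end Block

/-- **The shift block**: for an available occurrence of the shift kit, the zero gate `z`, the
consumer's comparator `(b, n)` available with `b < n`, the lines form a block concluding
`b >> 1 < n`. [cite: CookReckhow1979, §2] -/
theorem isBlock_lines (hGY : ∀ r ∈ Sys.sysRules, r ∈ G.rules) (hGS : ∀ r ∈ Sys.glue, r ∈ G.rules) {bB : ℕ}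
    (h : SAvail L o K Γ) (hB : (B L o bB).Avail K Γ L) (hz : ctx K (biimp (var (zv L o)) (const false)) ∈ Γ)
    (hlt : ctx K (neg (var ((B L o bB).ge L L))) ∈ Γ) (hL : 0 < L) : G.IsBlock Γ (lines K L o bB) := by
  refine ModAddU.AssocData.isBlock_flatten _ fun k hk => ?_
  simp only [segs, List.length_cons, List.length_nil] at hk
  have mem : ∀ {χ} (j : ℕ) (hj : j < k) (hχ : χ ∈ (segs K L o bB)[j]'(by simp [segs]; omega)),
      χ ∈ Γ ∪ {χ | ∃ j, ∃ hj : j < k, χ ∈ (segs K L o bB)[j]'(by simp [segs]; omega)} := fun j hj hχ => Or.inr ⟨j, hj, hχ⟩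
  have hΓ : Γ ⊆ Γ ∪ {χ | ∃ j, ∃ hj : j < k, χ ∈ (segs K L o bB)[j]'(by simp [segs]; omega)} := fun _ hχ => Or.inl hχ
  interval_cases k
  · -- 0: reading the copy gates: `b (i+1) ↔ px (i+1)` for `i + 1 < L`
    refine Scaffold.isBlock_of_forall fun θ hθ => ?_
    obtain ⟨i, hi, rfl⟩ := List.mem_map.1 hθ
    rw [List.mem_range] at hi
    refine Or.inr (Sys.glue_infer hGS 7 (by decide) (FregeSystem.sub [K, var (px L o (i + 1)), var (bv o (i + 1))]) rfl
      fun ψ hψ => ?_)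
    simp only [Sys.glue, List.getElem_cons_succ, List.getElem_cons_zero, Sys.rCopy, List.mem_singleton] at hψ
    subst hψ
    have e : hv L o i = bv o (i + 1) := by unfold hv bv; rw [if_pos (show i + 1 < L by omega)]
    show ctx K (biimp (var (px L o (i + 1))) (conj (var (bv o (i + 1))) (var (bv o (i + 1))))) ∈ _
    rw [← e]; exact hΓ (h.hpx i (by omega))
  · -- 1: the premises `f i ∨ (b i ↔ px i)`
    refine Scaffold.isBlock_of_forall fun θ hθ => ?_
    obtain ⟨i, hi, rfl⟩ := List.mem_map.1 hθ
    rw [List.mem_range] at hi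
    rcases Nat.eq_zero_or_pos i with rfl | hi0
    · refine Or.inr (Sys.glue_infer hGS 9 (by decide) (FregeSystem.sub [K, var (fl L o 0), biimp (var (bv o 0)) (var (px L o 0))])
        rfl fun ψ hψ => ?_)
      simp only [Sys.glue, List.getElem_cons_succ, List.getElem_cons_zero, Sys.rFlagT, List.mem_singleton] at hψ
      subst hψ; exact hΓ h.hfl
    · obtain ⟨j, rfl⟩ : ∃ j, i = j + 1 := ⟨i - 1, by omega⟩
      refine Or.inr (Sys.glue_infer hGS 10 (by decide)
        (FregeSystem.sub [K, var (fl L o (j + 1)), biimp (var (bv o (j + 1))) (var (px L o (j + 1)))]) rfl fun ψ hψ => ?_)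
      simp only [Sys.glue, List.getElem_cons_succ, List.getElem_cons_zero, Sys.rOrIntroR, List.mem_singleton] at hψ
      subst hψ; exact mem 0 (by omega) (List.mem_map.2 ⟨j, List.mem_range.2 (by omega), rfl⟩)
  · -- 2: the induction of `SHIFTR`
    refine System.isBlock_lines Sys.shiftrLeavesOK (hGY _ (Sys.mem_sysRules (i := 6) (by decide)))
      (hGY _ (Sys.mem_sysRules (i := 7) (by decide))) K (act L o bB) L
      (ModAddU.hcoh_of (p := fun k => decide (1 ≤ k ∧ k ≤ 4)) (by decide +kernel) fun i _ k hk => by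
        simp only [decide_eq_true_eq] at hk
        obtain ⟨hk₁, hk₂⟩ := hk
        interval_cases k
        · rfl
        · rfl
        · rfl
        · show fl L o (i + 1) = zv L o; unfold fl zv; rw [if_neg (Nat.succ_ne_zero i)])
      (fun φ hφ => ?_) (fun i hi φ hφ => ?_)
    · simp only [Sys.SHIFTR, List.mem_cons, List.not_mem_nil, or_false] at hφ
      rcases hφ with rfl | rfl | rfl | rfl
      · exact hΓ hB.2.1
      · exact hΓ h.hH.2.1
      · show ctx K (biimp (var (px L o 0)) (const false)) ∈ _; unfold px; rw [if_pos rfl]; exact hΓ hz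
      · exact hΓ h.hfl
    · simp only [Sys.SHIFTR, List.mem_cons, List.not_mem_nil, or_false] at hφ
      rcases hφ with rfl | rfl | rfl | rfl | rfl | rfl | rfl
      · exact hΓ (hB.1 i hi)
      · exact hΓ (hB.2.2 i hi).2
      · exact hΓ (h.hH.1 i hi)
      · exact hΓ (h.hH.2.2 i hi).2
      · exact hΓ (h.hpx i hi)
      · exact hΓ hz
      · exact mem 1 (by omega) (List.mem_map.2 ⟨i, List.mem_range.2 hi, rfl⟩)
  · -- 3: `¬px L` (a copy of the zero gate)
    obtain ⟨L', rfl⟩ : ∃ L', L = L' + 1 := ⟨L - 1, by omega⟩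
    refine FregeSystem.IsBlock.singleton (Or.inr (Sys.glue_infer hGS 8 (by decide)
      (FregeSystem.sub [K, var (px (L' + 1) o (L' + 1)), var (zv (L' + 1) o)]) rfl fun ψ hψ => ?_))
    simp only [Sys.glue, List.getElem_cons_succ, List.getElem_cons_zero, Sys.rCopyCstF, List.mem_cons, List.not_mem_nil,
      or_false] at hψ
    rcases hψ with rfl | rfl
    · have e : hv (L' + 1) o L' = zv (L' + 1) o := by unfold hv zv; rw [if_neg (by omega)]
      show ctx K (biimp (var (px (L' + 1) o (L' + 1))) (conj (var (zv (L' + 1) o)) (var (zv (L' + 1) o)))) ∈ _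
      rw [← e]; exact hΓ (h.hpx L' (by omega))
    · exact hΓ hz
  · -- 4: the end: `b >> 1 < n`
    exact FregeSystem.IsBlock.singleton (Or.inr (System.isInferredFrom_end Sys.shiftrLeavesOK.inv_ne_zero
      (hGY _ (Sys.mem_sysRules (i := 8) (by decide))) (System.forall_ne_zero_of_shapesOKB (by decide +kernel))
      (ModAddU.ne_zero_of_allVarsB (by decide +kernel)) K (act L o bB) L
      (mem 2 (by omega) (System.mem_lines Sys.SHIFTR K _ le_rfl)) fun φ hφ => by
        simp only [List.mem_cons, List.not_mem_nil, or_false] at hφ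
        rcases hφ with rfl | rfl
        · exact hΓ hlt
        · exact mem 3 (by omega) (List.mem_singleton_self _)))

/-- **The conclusion of the shift block**: `b >> 1 < n`. [folklore] -/
theorem mem_lines {bB : ℕ} : ctx K (neg (var ((H L o).ge L L))) ∈ lines K L o bB := by
  simp only [lines, segs, List.flatten_cons, List.flatten_nil, List.mem_append, List.append_nil, List.mem_singleton]
  exact Or.inr (Or.inr (Or.inr (Or.inr rfl)))

/-- **Size of the shift block**: `≤ (3L + 3)(|K| + 100)`. [folklore] -/
theorem proofSize_lines (bB : ℕ) : proofSize (lines K L o bB) ≤ (3 * L + 3) * (K.size + 100) := by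
  have hI : Sys.SHIFTR.inv.size ≤ 96 := by decide +kernel
  refine (ModAddU.Bounded.proofSize_le (B := K.size + 100) (ModAddU.Bounded.flatten fun D hD => ?_)).trans ?_
  · simp only [segs, List.mem_cons, List.not_mem_nil, or_false] at hD
    rcases hD with rfl | rfl | rfl | rfl | rfl
    · exact ModAddU.Bounded.map fun i _ => by rw [ModAddU.size_ctx, FregeSystem.size_biimp]; simp [size]
    · exact ModAddU.Bounded.map fun i _ => by rw [ModAddU.size_ctx]; simp [size, FregeSystem.size_biimp]
    · exact ModAddU.bounded_sysLines _ _ _ _ (by omega)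
    · exact ModAddU.Bounded.singleton (by rw [ModAddU.size_ctx]; simp [size])
    · exact ModAddU.Bounded.singleton (by rw [ModAddU.size_ctx, ModAddU.size_inst]; simp [size])
  · apply Nat.mul_le_mul_right
    simp only [segs, List.flatten_cons, List.flatten_nil, List.length_append, List.length_map, List.length_range,
      System.lines, List.length_cons, List.length_nil, List.append_nil]
    omega

/-! ### Disjoint sums -/

/-- Leaf assignment of `DOR` for an adder view `S` (carry-in false). [folklore] -/
def dorAct (S : Adder.View) (i : ℕ) (k : ℕ) : ℕ := [0, S.c i, S.x i, S.y i, S.s i, S.c (i + 1)].getD k 0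

/-- The disjoint-sum lines: the induction of `DOR` and the sum bits. [folklore] -/
def dorLines (S : Adder.View) (K : PropForm ℕ) (L : ℕ) : List (PropForm ℕ) :=
  Sys.DOR.lines K (dorAct S) L ++ (List.range L).map fun i => ctx K (inst (dorAct S i) (biimp (var 4) (disj (var 2) (var 3))))

/-- **Disjoint sum**: for an adder with carry-in false on words of disjoint support (premise lines
`¬(xᵢ ∧ yᵢ)`), every sum bit is `xᵢ ∨ yᵢ`. [cite: CookReckhow1979, §2] -/
theorem isBlock_dorLines (hGY : ∀ r ∈ Sys.sysRules, r ∈ G.rules) {S : Adder.View} (hS : S.Avail K T false L)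
    (hd : ∀ i < L, ctx K (neg (conj (var (S.x i)) (var (S.y i)))) ∈ T) : G.IsBlock T (dorLines S K L) := by
  have hsh : ∀ {T' : Set (PropForm ℕ)}, T ⊆ T' → ∀ i < L, ∀ φ ∈ Sys.DOR.shapes, ctx K (inst (dorAct S i) φ) ∈ T' := by
    intro T' hT i hi φ hφ
    simp only [Sys.DOR, List.mem_cons, List.not_mem_nil, or_false] at hφ
    rcases hφ with rfl | rfl | rfl
    exacts [hT (hS.2 i hi).1, hT (hS.2 i hi).2, hT (hd i hi)]
  refine (System.isBlock_lines Sys.dorLeavesOK (hGY _ (Sys.mem_sysRules (i := 0) (by decide)))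
    (hGY _ (Sys.mem_sysRules (i := 1) (by decide))) K (dorAct S) L
    (ModAddU.hcoh_of (p := fun k => decide (k = 1)) (by decide +kernel) fun i _ k hk => by
      simp only [decide_eq_true_eq] at hk; subst hk; rfl)
    (fun φ hφ => by
      simp only [Sys.DOR, List.mem_cons, List.not_mem_nil, or_false] at hφ
      subst hφ; exact hS.1)
    (hsh le_rfl)).append (Scaffold.isBlock_of_forall fun θ hθ => ?_)
  obtain ⟨i, hi, rfl⟩ := List.mem_map.1 hθ
  rw [List.mem_range] at hi
  exact Or.inr (System.isInferredFrom_end Sys.dorLeavesOK.inv_ne_zero (hGY _ (Sys.mem_sysRules (i := 2) (by decide)))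
    Sys.dorLeavesOK.2.1 (ModAddU.ne_zero_of_allVarsB (by decide +kernel)) K (dorAct S) i
    (Or.inr (System.mem_lines Sys.DOR K _ hi.le)) (hsh Set.subset_union_left i hi))

/-- The conclusions of the disjoint sum: `sᵢ ↔ xᵢ ∨ yᵢ`. [folklore] -/
theorem mem_dorLines {S : Adder.View} {i : ℕ} (hi : i < L) :
    ctx K (biimp (var (S.s i)) (disj (var (S.x i)) (var (S.y i)))) ∈ dorLines S K L :=
  List.mem_append_right _ (List.mem_map.2 ⟨i, List.mem_range.2 hi, rfl⟩)

/-- Size of the disjoint sum. [folklore] -/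
theorem proofSize_dorLines (S : Adder.View) (K : PropForm ℕ) (L : ℕ) : proofSize (dorLines S K L) ≤ (2 * L + 1) * (K.size + 20) := by
  have hI : Sys.DOR.inv.size ≤ 8 := by decide +kernel
  refine ((ModAddU.bounded_sysLines (B := K.size + 20) _ _ _ _ (by omega)).append (ModAddU.Bounded.map fun i _ => ?_)).proofSize_le.trans ?_
  · rw [ModAddU.size_ctx, ModAddU.size_inst]; simp [size, FregeSystem.size_biimp]
  · simp [System.lines]; nlinarith

end Shift

end ModMulU

end Literature.Computability.MetaComplexity
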